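import Summits.ResolutionOfSingularities.ResolutionOfSingularities.Theses.FrobeniusClosing

/-!
# Disproof of `ClosingReduction` (stmt-ResolutionOfSingularities-16347) — findings

Crux: `ClosingReduction := NoPeriodicIsolatedAtom → BoundedMilnor → IsolatedForcedTermination`
(route `ResolutionOfSingularities/FrobeniusClosing`, rank 5). Disprover seat
`refuter-cdisprove-stmt-ResolutionOfSingularities-16347-0`, cycle 1 (2026-08-17).

VERDICT OF THIS CYCLE: **no kill; the crux resists** — and it resists for a STRUCTURAL reason that
every reader should know before spending time on "counterexamples":

1. `¬ ClosingReduction ↔ NoPeriodicIsolatedAtom ∧ BoundedMilnor ∧ ¬ IsolatedForcedTermination`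
   (`not_closingReduction_iff`). A refutation must PROVE the certificate N (no periodic isolated atom
   over any field algebraic over `𝔽_p`, all `p`, all `n`) AND the bound B, AND exhibit an eternal
   isolated multiplicity-`p` run (¬T). N and ¬T are both open (¬T is Hauser–Perlega's missing
   "forced" example); so `¬ ClosingReduction` is not landable by any cheap means, and NO COMPUTATION
   can refute the crux: every computational witness in the arena (a cycle ⇒ ¬N; a μ-pumping chain ⇒
   ¬B) makes the crux VACUOUSLY TRUE (`closingReduction_of_not_noPeriodic`,
   `closingReduction_of_not_boundedMilnor`), and T itself implies it (`closingReduction_of_target`).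
2. Dropping either hypothesis gives `B → T` resp. `N → T`; neither is refutable without the same
   eternal isolated run (`…WithoutNoPeriodic`, `…WithoutBoundedMilnor` below, with the exact
   residual statements). "Any proof must use N" / "must use B" therefore cannot be certified by a
   `_false_without_` theorem here; what CAN be said: T → B is trivial (`boundedMilnor_of_target`), so
   B carries information only in the counterfactual world ¬T in which the crux operates, and the
   closing argument of both registered lines really proves the RUN-WISE strengthening
   `N → ∀ run, (∀ m, Isol ∧ MultP) → μ unbounded along THAT run` (`ClosingReductionRunwise`,
   `closingReduction_of_runwise`) — provers lose nothing by aiming at it.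
3. What IS load-bearing and certified here (small models, kernel-checked, no `sorry`):
   * `Isol` (forcedness) is load-bearing in the conclusion AND in the certificate: the atom
     `z² = u₀·u₁²` over `𝔽₂` (`n = 2`) reproduces itself EXACTLY after one point blow-up (chart `u₀`,
     point `0`): an eternal multiplicity-`p` run (`isolatedForcedTermination_false_without_Isol`)
     which is 1-periodic on the nose (`noPeriodicIsolatedAtom_false_without_Isol`); it is NOT
     isolated (`not_isol_cst`: `u₀ᵏ` are independent modulo `jac = (u₁²)`), i.e. it is the classical
     unforced curve-blow-up configuration (singular locus = the `u₀`-axis), Hauser–Perlega's cycles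
     in miniature — exactly what the route's restriction to ISOLATED points excludes.
   * `MultP` is load-bearing (trivially): the smooth germ `a = u₀` (`n = 1`) is an eternal "isolated"
     run (`isolatedForcedTermination_false_without_MultP`; Milnor algebra `= 0`).
   * Dimension `n = 1` carries no counterexample: the conclusion T HOLDS for `n = 1` over every field
     (`isolatedForcedTermination_dim_one`: the cleaned order drops by exactly `p` at every step, so a
     multiplicity-`p` run of length `> ord(a₀)/p` does not exist). With `n = 2` excluded on paper by
     Zariski–Lipman (an isolated hypersurface point of a surface is normal, so a chain of isolated
     infinitely near singular points is a chain of "blow up + normalise", which resolves), an honest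
     ¬T needs `n ≥ 3`, `p ≥ 3` most likely (char 2 behaves like a budget regime in all toys on file:
     item notes of 16343/16344, VETTING of 16347: 2700+ nodes, μ never rose, 0 recurrences).
4. Where a disproof WOULD have to come from (regimes examined, none yields a construction):
   (a) an eternal isolated run over a TRANSCENDENTAL perfect field (`𝔽_p(s)^{perf}`,
   `𝔽̄_p((s))^{perf}`) with bounded μ whose jet-classes never recur — this is precisely a
   counterexample to the support item `ClosingLemma` INSIDE the blow-up arena; the two independent
   proofs of `ClosingLemma` on file (CLOSING-LEMMA-PLAN.md: ultrapower recurrence + Varshavsky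
   Thm 0.1; and the model-theoretic route: shift-invariant path type + Hrushovski's theorem that
   non-principal ultraproducts of `(𝔽̄_p, Frob_q)` are models of ACFA, so an existential sentence
   `∃ x, (x, σx) ∈ T` true in one difference field of char `p` holds in some `(𝔽̄_p, Frob_q)`) leave
   no configuration I could turn into such a run (tried: Artin–Schreier towers, radical towers,
   shift-with-dead-ends, parameter-carrying states `(x, y) ↦ (x, x·y)`, alternating generic/special
   itineraries — each has a Frobenius-periodic orbit or a bi-dominant iterate);
   (b) a leak in the ARENA (jets/determinacy/transport): checked by hand against the registered
   stubs of BOTH lines — `Factorization` (universal property of the point blow-up; true over every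
   field), `TransportKit` (the identity `φ'(ser (step i τ c)) = (σ'(v)/Uᵢ)ᵖ · ser (step i' τ' c') +
   (…)ᵖ` with `g(0) = 0` forced by cleaned constant terms and `σ'(g) ∈ (u_{i'})`), `PairDeterminacy`
   (BGM Cor. 2.4 as vendored: `2β + 2 ≥ 2μ − ord + 2`; `n = 1` by Hensel since cleaned orders are
   prime to `p`), `MilnorJet` (`μ ≤ β ⟺ dim K[[u]]/(j(a) + 𝔪^{β+1}) ≤ β` by Nakayama, a rank
   condition made Diophantine by a left-inverse witness), `ArenaE`/`ArenaConstructible`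
   (ENCODE over perfect `K` via `K̄`-witnesses, DECODE by determinacy twice + ONE transport, whose
   chart change `(i, τ) ↦ (i', τ')` is absorbed by the `∃ i τ` of `BddSucc`), `Unwinding` (needs
   `PerfectField K` for `K` algebraic over `𝔽_p`: Mathlib `Algebra.IsAlgebraic.perfectField`).
   No stub is false as stated; no junk instance (empty chart word, `n = 0` is excluded by `0 < n`,
   `p = 2`, `τ` with a junk `i`-th component — ignored by `tr`) breaks one.
   (c) the vendored facts: `Varshavsky2014TwistedLangWeil` sanity-checked at `N = 1` on
   `P = (Y − X − 1)`, `(Y² − X)`, `(XY − 1)`, `(Y − Xᵖ)` (solutions `x^{qⁿ} = x + 1`, … exist in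
   `𝔽̄_p`); `BoubakriGreuelMarkwig.Cor24` consistent with Morse/`A_k` determinacy orders.

Targets (lead's stuck stubs): none on file this cycle (`payload.stuck_stubs = []`).
Near-misses: none left with `sorry` — everything stated below is proved.

LANDED under `Theorems/ClosingReduction/Negative/` (def-free, the route's `let`-telescopes verbatim with one
predicate deleted; importable): `LoadBearing.lean` (p153821: `isolatedForcedTermination_false_without_Isol`,
`noPeriodicIsolatedAtom_false_without_Isol`, `curveBlowUp_witness_not_isolated`, `curveBlowUp_run_const`,
`taylorShift_zero`) and `DimensionOne.lean` (p153871: `isolatedForcedTermination_false_without_MultP`,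
`isolatedForcedTermination_dim_one`, `blowupChart_fin_one`, `taylorShift_fin_one`).

How provers should read this file: the named dynamics in § Dynamics are VERBATIM the route's `let`s
(bridges `…_iff` are `Iff.rfl`), identical to `Lines/birth.lean` and `Lines/chart_factorization.lean`;
the computation lemmas (`tr_zero`, `run_succ`, `clean_clean`, the `Fin 1` collapse of `bl`/`tr`,
`ord` via `Nat.sInf`) are the first honest evaluations of the route's coefficient calculus inside
Lean and can be copied.
-/

noncomputable section

-- single-problem summit: the doubled namespace component `ResolutionOfSingularities` is forced
set_option linter.dupNamespace false

open scoped BigOperators Classical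

open Summit.ResolutionOfSingularities.ResolutionOfSingularities.Theses.FrobeniusClosing
  (ClosingReduction NoPeriodicIsolatedAtom BoundedMilnor IsolatedForcedTermination ClosingLemma)

namespace Summit.ResolutionOfSingularities.ResolutionOfSingularities.Cruxes.ClosingReduction.Disproof

/-! ## Dynamics — the route's `let`s, named (verbatim; see the bridges below) -/

section Dynamics

variable (p n : ℕ) (κ : Type) [Field κ]

/-- `clean c`: delete the `p`-th-power monomials. [folklore] -/
def clean (c : (Fin n → ℕ) → κ) : (Fin n → ℕ) → κ :=
  fun A => @ite κ (∀ j, p ∣ A j) (Classical.dec _) 0 (c A)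

/-- `bl i c`: chart `i` of the blow-up of the closed point. [folklore] -/
def bl (i : Fin n) (c : (Fin n → ℕ) → κ) : (Fin n → ℕ) → κ :=
  fun B => @ite κ (Finset.sum (Finset.univ.erase i) (fun j => B j) ≤ B i) (Classical.dec _)
    (c (Function.update B i (B i - Finset.sum (Finset.univ.erase i) (fun j => B j)))) 0

/-- `ord c`: the order. [folklore] -/
def ord (c : (Fin n → ℕ) → κ) : ℕ :=
  sInf {m : ℕ | ∃ A, c A ≠ 0 ∧ m = Finset.sum Finset.univ (fun j => A j)}

/-- `dv i s c`: divide by `u_i ^ s`. [folklore] -/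
def dv (i : Fin n) (s : ℕ) (c : (Fin n → ℕ) → κ) : (Fin n → ℕ) → κ :=
  fun B => c (Function.update B i (B i + s))

/-- `tr i τ s c`: Taylor shift to the point `u_j = τ_j` (`j ≠ i`). [folklore] -/
def tr (i : Fin n) (τ : Fin n → κ) (s : ℕ) (c : (Fin n → ℕ) → κ) : (Fin n → ℕ) → κ :=
  fun B => Finset.sum (Fintype.piFinset (fun _ : Fin n => Finset.range (B i + s + 1)))
    (fun D => @ite κ (D i = 0) (Classical.dec _) (c (B + D) * Finset.prod (Finset.univ.erase i)
      (fun j => ((Nat.choose (B j + D j) (B j) : ℕ) : κ) * τ j ^ (D j))) 0)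

/-- `step i τ c`: one move of the dynamics. [folklore] -/
def step (i : Fin n) (τ : Fin n → κ) (c : (Fin n → ℕ) → κ) : (Fin n → ℕ) → κ :=
  clean p n κ (tr n κ i τ (@ite ℕ (p ≤ ord n κ (clean p n κ c)) (Classical.dec _) p 0)
    (dv n κ i (@ite ℕ (p ≤ ord n κ (clean p n κ c)) (Classical.dec _) p 0) (bl n κ i (clean p n κ c))))

/-- `run c₀ i t m`: the `m`-th state. [folklore] -/
def run (c₀ : (Fin n → ℕ) → κ) (i : ℕ → Fin n) (t : ℕ → Fin n → κ) (m : ℕ) : (Fin n → ℕ) → κ :=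
  @Nat.rec (fun _ => (Fin n → ℕ) → κ) c₀ (fun m c => step p n κ (i m) (t m) c) m

/-- `ser c`: the cleaned series. [folklore] -/
def ser (c : (Fin n → ℕ) → κ) : MvPowerSeries (Fin n) κ :=
  show MvPowerSeries (Fin n) κ from fun A : Fin n →₀ ℕ => clean p n κ c ⇑A

/-- `pd i f = ∂f/∂u_i`. [folklore] -/
def pd (i : Fin n) (f : MvPowerSeries (Fin n) κ) : MvPowerSeries (Fin n) κ :=
  show MvPowerSeries (Fin n) κ from fun A : Fin n →₀ ℕ => ((A i + 1 : ℕ) : κ) * f (A + Finsupp.single i 1)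

/-- `jac c`: the Jacobian ideal of the cleaned series. [folklore] -/
def jac (c : (Fin n → ℕ) → κ) : Ideal (MvPowerSeries (Fin n) κ) :=
  Ideal.span (Set.range (fun i => pd n κ i (ser p n κ c)))

/-- `Isol c`: finite Milnor algebra. [folklore] -/
def Isol (c : (Fin n → ℕ) → κ) : Prop :=
  Module.Finite κ (MvPowerSeries (Fin n) κ ⧸ jac p n κ c)

/-- `MultP c`: cleaned series non-zero of order `≥ p`. [folklore] -/
def MultP (c : (Fin n → ℕ) → κ) : Prop :=
  (∃ A, clean p n κ c A ≠ 0) ∧ ∀ A, clean p n κ c A ≠ 0 → p ≤ Finset.sum Finset.univ (fun j => A j)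

/-- `mu c`: Milnor-type colength (`finrank`). [folklore] -/
def mu (c : (Fin n → ℕ) → κ) : ℕ :=
  Module.finrank κ (MvPowerSeries (Fin n) κ ⧸ jac p n κ c)

/-- `PairIso c c'`: isomorphism of pairs `(κ[[u]], [a])`. [folklore] -/
def PairIso (c c' : (Fin n → ℕ) → κ) : Prop :=
  ∃ (φ : MvPowerSeries (Fin n) κ ≃ₐ[κ] MvPowerSeries (Fin n) κ) (v g : MvPowerSeries (Fin n) κ),
    IsUnit v ∧ φ (ser p n κ c) = v ^ p * ser p n κ c' + g ^ p

end Dynamics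

/-! ## Bridges (definitional) -/

/-- [folklore] -/
theorem isolatedForcedTermination_iff :
    IsolatedForcedTermination ↔
      ∀ p : ℕ, p.Prime → ∀ n : ℕ, 0 < n → ∀ (κ : Type) [Field κ] [CharP κ p] [PerfectField κ]
        (c₀ : (Fin n → ℕ) → κ) (i : ℕ → Fin n) (t : ℕ → Fin n → κ),
        ¬ (∀ m, Isol p n κ (run p n κ c₀ i t m) ∧ MultP p n κ (run p n κ c₀ i t m)) :=
  Iff.rfl

/-- [folklore] -/
theorem boundedMilnor_iff :
    BoundedMilnor ↔
      ∀ p : ℕ, p.Prime → ∀ n : ℕ, 0 < n → ∀ (κ : Type) [Field κ] [CharP κ p] [PerfectField κ]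
        (c₀ : (Fin n → ℕ) → κ) (i : ℕ → Fin n) (t : ℕ → Fin n → κ),
        (∀ m, Isol p n κ (run p n κ c₀ i t m) ∧ MultP p n κ (run p n κ c₀ i t m)) →
          ∃ β : ℕ, ∀ m, mu p n κ (run p n κ c₀ i t m) ≤ β :=
  Iff.rfl

/-- [folklore] -/
theorem noPeriodicIsolatedAtom_iff :
    NoPeriodicIsolatedAtom ↔
      ∀ p : ℕ, p.Prime → ∀ n : ℕ, 0 < n → ∀ (κ : Type) [Field κ] [Algebra (ZMod p) κ]
        [Algebra.IsAlgebraic (ZMod p) κ] (c₀ : (Fin n → ℕ) → κ) (i : ℕ → Fin n) (t : ℕ → Fin n → κ)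
        (r : ℕ), 0 < r →
        (∀ m, m ≤ r → Isol p n κ (run p n κ c₀ i t m) ∧ MultP p n κ (run p n κ c₀ i t m)) →
          ¬ PairIso p n κ (run p n κ c₀ i t 0) (run p n κ c₀ i t r) :=
  Iff.rfl

/-! ## (a) Load-bearing analysis of the two hypotheses — what a refutation must contain -/

/-- A refutation of the crux is EXACTLY: the certificate, the bound, and an eternal isolated run.
[folklore] -/
theorem not_closingReduction_iff :
    ¬ ClosingReduction ↔
      (NoPeriodicIsolatedAtom ∧ BoundedMilnor ∧ ¬ IsolatedForcedTermination) := by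
  unfold ClosingReduction; tauto

/-- The target implies the bound (vacuously: no infinite isolated run to bound). [folklore] -/
theorem boundedMilnor_of_target : IsolatedForcedTermination → BoundedMilnor := by
  rw [isolatedForcedTermination_iff, boundedMilnor_iff]
  intro hT p hp n hn κ _ _ _ c₀ i t hrun
  exact (hT p hp n hn κ c₀ i t hrun).elim

/-- The target implies the crux. [folklore] -/
theorem closingReduction_of_target : IsolatedForcedTermination → ClosingReduction :=
  fun h _ _ => h

/-- A periodic isolated atom (¬N) makes the crux vacuous. [folklore] -/
theorem closingReduction_of_not_noPeriodic : ¬ NoPeriodicIsolatedAtom → ClosingReduction :=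
  fun h hN _ => (h hN).elim

/-- A μ-pumping eternal isolated chain (¬B) makes the crux vacuous. [folklore] -/
theorem closingReduction_of_not_boundedMilnor : ¬ BoundedMilnor → ClosingReduction :=
  fun h _ hB => (h hB).elim

/-- The crux with the CERTIFICATE dropped. Residual statement: `B → T`; refuting it needs ¬T (an
eternal isolated multiplicity-`p` run — open) together with B. Not refutable here. [folklore] -/
def ClosingReductionWithoutNoPeriodic : Prop := BoundedMilnor → IsolatedForcedTermination

/-- The crux with the BOUND dropped. Residual statement: `N → T`; refuting it needs ¬T together
with the certificate N — i.e. a μ-PUMPING eternal isolated run plus a proof that no isolated atom is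
periodic. Not refutable here. [folklore] -/
def ClosingReductionWithoutBoundedMilnor : Prop := NoPeriodicIsolatedAtom → IsolatedForcedTermination

/-- Both weakenings imply the crux (so they are genuinely stronger claims). [folklore] -/
theorem closingReduction_of_without :
    (ClosingReductionWithoutNoPeriodic → ClosingReduction) ∧
      (ClosingReductionWithoutBoundedMilnor → ClosingReduction) :=
  ⟨fun h _ hB => h hB, fun h hN _ => h hN⟩

/-- What the refutations of the weakenings would have to be. [folklore] -/
theorem not_without_iff :
    (¬ ClosingReductionWithoutNoPeriodic ↔ BoundedMilnor ∧ ¬ IsolatedForcedTermination) ∧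
      (¬ ClosingReductionWithoutBoundedMilnor ↔
        NoPeriodicIsolatedAtom ∧ ¬ IsolatedForcedTermination) := by
  unfold ClosingReductionWithoutNoPeriodic ClosingReductionWithoutBoundedMilnor
  constructor <;> tauto

/-- The RUN-WISE strengthening which the closing argument of both registered lines actually proves:
under the certificate, along EVERY eternal isolated multiplicity-`p` run μ is unbounded. [folklore] -/
def ClosingReductionRunwise : Prop :=
  NoPeriodicIsolatedAtom →
    ∀ p : ℕ, p.Prime → ∀ n : ℕ, 0 < n → ∀ (κ : Type) [Field κ] [CharP κ p] [PerfectField κ]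
      (c₀ : (Fin n → ℕ) → κ) (i : ℕ → Fin n) (t : ℕ → Fin n → κ),
      (∀ m, Isol p n κ (run p n κ c₀ i t m) ∧ MultP p n κ (run p n κ c₀ i t m)) →
        ∀ β : ℕ, ∃ m, β < mu p n κ (run p n κ c₀ i t m)

/-- The run-wise form implies the crux. [folklore] -/
theorem closingReduction_of_runwise : ClosingReductionRunwise → ClosingReduction := by
  intro h hN hB
  rw [isolatedForcedTermination_iff]
  intro p hp n hn κ _ _ _ c₀ i t hrun
  obtain ⟨β, hβ⟩ := boundedMilnor_iff.1 hB p hp n hn κ c₀ i t hrun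
  obtain ⟨m, hm⟩ := h hN p hp n hn κ c₀ i t hrun β
  exact absurd (hβ m) (not_le.2 hm)

/-! ## (b) Computation lemmas for the route's coefficient calculus -/

section Compute

variable {p n : ℕ} {κ : Type} [Field κ]

/-- [folklore] -/
theorem run_zero (c₀ : (Fin n → ℕ) → κ) (i : ℕ → Fin n) (t : ℕ → Fin n → κ) :
    run p n κ c₀ i t 0 = c₀ := rfl

/-- [folklore] -/
theorem run_succ (c₀ : (Fin n → ℕ) → κ) (i : ℕ → Fin n) (t : ℕ → Fin n → κ) (m : ℕ) :
    run p n κ c₀ i t (m + 1) = step p n κ (i m) (t m) (run p n κ c₀ i t m) := rfl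

/-- `clean` is idempotent. [folklore] -/
theorem clean_clean (c : (Fin n → ℕ) → κ) : clean p n κ (clean p n κ c) = clean p n κ c := by
  funext A
  unfold clean
  split_ifs <;> rfl

/-- A coefficient surviving `clean` is a coefficient of `c`. [folklore] -/
theorem clean_ne_zero {c : (Fin n → ℕ) → κ} {A : Fin n → ℕ} (h : clean p n κ c A ≠ 0) :
    c A ≠ 0 ∧ ¬ ∀ j, p ∣ A j := by
  unfold clean at h
  split_ifs at h with hd
  · exact (h rfl).elim
  · exact ⟨h, hd⟩

/-- `clean c A` in the surviving case. [folklore] -/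
theorem clean_of_not_dvd {c : (Fin n → ℕ) → κ} {A : Fin n → ℕ} (h : ¬ ∀ j, p ∣ A j) :
    clean p n κ c A = c A := by
  unfold clean
  rw [if_neg h]

/-- Every state of a run from index `1` on is cleaned. [folklore] -/
theorem clean_step (i : Fin n) (τ : Fin n → κ) (c : (Fin n → ℕ) → κ) :
    clean p n κ (step p n κ i τ c) = step p n κ i τ c := by
  unfold step
  exact clean_clean _

/-- TRANSLATION BY ZERO IS THE IDENTITY (the point `u_j = 0` of the exceptional divisor).
[folklore] -/
theorem tr_zero (i : Fin n) (s : ℕ) (c : (Fin n → ℕ) → κ) :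
    tr n κ i (fun _ => 0) s c = c := by
  funext B
  unfold tr
  rw [Finset.sum_eq_single (0 : Fin n → ℕ)]
  · simp
  · intro D _ hD0
    by_cases hDi : D i = 0
    · rw [if_pos hDi]
      obtain ⟨j, hj⟩ : ∃ j, D j ≠ 0 := by
        by_contra h
        push Not at h
        exact hD0 (funext h)
      have hji : j ≠ i := fun h => hj (h ▸ hDi)
      apply mul_eq_zero_of_right
      apply Finset.prod_eq_zero (Finset.mem_erase.2 ⟨hji, Finset.mem_univ j⟩)
      simp [hj]
    · rw [if_neg hDi]
  · intro h0
    exfalso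
    apply h0
    simp [Fintype.mem_piFinset]

/-- With `MultP`, the cleaned order is `≥ p` (so the step divides by `u_i ^ p`). [folklore] -/
theorem le_ord_clean_of_multP {c : (Fin n → ℕ) → κ} (h : MultP p n κ c) :
    p ≤ ord n κ (clean p n κ c) := by
  obtain ⟨⟨A₀, hA₀⟩, hmin⟩ := h
  unfold ord
  have hne : {m : ℕ | ∃ A, clean p n κ c A ≠ 0 ∧ m = Finset.sum Finset.univ (fun j => A j)}.Nonempty :=
    ⟨_, A₀, hA₀, rfl⟩
  obtain ⟨A, hA, hm⟩ := Nat.sInf_mem hne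
  rw [hm]
  exact hmin A hA

/-- The order is attained. [folklore] -/
theorem exists_eq_ord {c : (Fin n → ℕ) → κ} (h : ∃ A, c A ≠ 0) :
    ∃ A, c A ≠ 0 ∧ ord n κ c = Finset.sum Finset.univ (fun j => A j) := by
  obtain ⟨A₀, hA₀⟩ := h
  unfold ord
  have hne : {m : ℕ | ∃ A, c A ≠ 0 ∧ m = Finset.sum Finset.univ (fun j => A j)}.Nonempty :=
    ⟨_, A₀, hA₀, rfl⟩
  obtain ⟨A, hA, hm⟩ := Nat.sInf_mem hne
  exact ⟨A, hA, hm⟩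

/-- The order is a lower bound. [folklore] -/
theorem ord_le {c : (Fin n → ℕ) → κ} {A : Fin n → ℕ} (h : c A ≠ 0) :
    ord n κ c ≤ Finset.sum Finset.univ (fun j => A j) := by
  unfold ord
  exact Nat.sInf_le ⟨A, h, rfl⟩

end Compute

/-! ## (c) Small models: `Isol` and `MultP` are load-bearing; dimension one is empty -/

section DimOne

variable {p : ℕ} {κ : Type} [Field κ]

/-- In dimension `n = 1` the blow-up chart is the identity on coefficients. [folklore] -/
theorem bl_fin_one (i : Fin 1) (c : (Fin 1 → ℕ) → κ) : bl 1 κ i c = c := by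
  funext B
  have he : (Finset.univ : Finset (Fin 1)).erase i = ∅ := by
    ext j; simp [Subsingleton.elim j i]
  have hs : Finset.sum (Finset.univ.erase i) (fun j => B j) = 0 := by
    rw [he, Finset.sum_empty]
  unfold bl
  rw [hs]
  simp

/-- In dimension `n = 1` there is nothing to translate. [folklore] -/
theorem tr_fin_one (i : Fin 1) (τ : Fin 1 → κ) (s : ℕ) (c : (Fin 1 → ℕ) → κ) :
    tr 1 κ i τ s c = c := by
  funext B
  have he : (Finset.univ : Finset (Fin 1)).erase i = ∅ := by
    ext j; simp [Subsingleton.elim j i]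
  unfold tr
  rw [Finset.sum_eq_single (0 : Fin 1 → ℕ)]
  · rw [if_pos (show (0 : Fin 1 → ℕ) i = 0 from rfl), he, Finset.prod_empty, mul_one, add_zero]
  · intro D _ hD0
    have hDi : D i ≠ 0 := by
      intro h
      apply hD0
      funext j
      rw [Subsingleton.elim j i, h]
      rfl
    rw [if_neg hDi]
  · intro h0
    exfalso
    apply h0
    simp [Fintype.mem_piFinset]

/-- The one-dimensional step: shift the cleaned coefficients down by `s` and clean, where `s = p`
if the cleaned order is `≥ p` and `s = 0` otherwise. [folklore] -/
theorem step_fin_one (i : Fin 1) (τ : Fin 1 → κ) (c : (Fin 1 → ℕ) → κ) :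
    step p 1 κ i τ c =
      clean p 1 κ (fun B => clean p 1 κ c
        (Function.update B i (B i + @ite ℕ (p ≤ ord 1 κ (clean p 1 κ c)) (Classical.dec _) p 0))) := by
  unfold step
  rw [tr_fin_one, bl_fin_one]
  rfl

/-- **Dimension one carries no counterexample: the conclusion `IsolatedForcedTermination` HOLDS for
`n = 1`** (over every field; neither perfectness nor the characteristic is used): along a
multiplicity-`p` run the cleaned order drops by `p` at every step. [folklore] -/
theorem isolatedForcedTermination_dim_one (hp : p.Prime) (c₀ : (Fin 1 → ℕ) → κ) (i : ℕ → Fin 1)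
    (t : ℕ → Fin 1 → κ) :
    ¬ (∀ m, Isol p 1 κ (run p 1 κ c₀ i t m) ∧ MultP p 1 κ (run p 1 κ c₀ i t m)) := by
  intro h
  have hM : ∀ m, MultP p 1 κ (run p 1 κ c₀ i t m) := fun m => (h m).2
  -- the potential: cleaned order of the `m`-th state
  set N : ℕ → ℕ := fun m => ord 1 κ (clean p 1 κ (run p 1 κ c₀ i t m)) with hN
  have hdrop : ∀ m, N (m + 1) + p ≤ N m := by
    intro m
    obtain ⟨A, hA, hordA⟩ := exists_eq_ord (hM m).1
    have hpA : p ≤ Finset.sum Finset.univ (fun j => A j) := (hM m).2 A hA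
    have hsumA : Finset.sum Finset.univ (fun j => A j) = A (i m) := by
      rw [Fintype.sum_eq_single (i m) (fun j hj => (hj (Subsingleton.elim j (i m))).elim)]
    have hndvd : ¬ ∀ j, p ∣ A j := (clean_ne_zero hA).2
    -- the witness monomial of the next state: exponent `A (i m) - p`
    set B : Fin 1 → ℕ := fun _ => A (i m) - p with hB
    have hBupd : Function.update B (i m) (B (i m) + p) = A := by
      funext j
      rw [Subsingleton.elim j (i m), Function.update_self, hB]
      show A (i m) - p + p = A (i m)
      have := hsumA ▸ hpA
      omega
    have hstep : run p 1 κ c₀ i t (m + 1) B ≠ 0 := by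
      rw [run_succ, step_fin_one, if_pos (le_ord_clean_of_multP (hM m))]
      have hBndvd : ¬ ∀ j, p ∣ B j := by
        intro hd
        apply hndvd
        intro j
        rw [Subsingleton.elim j (i m)]
        have h1 : p ∣ A (i m) - p := by simpa [hB] using hd (i m)
        have h2 : p ≤ A (i m) := hsumA ▸ hpA
        have : A (i m) = (A (i m) - p) + p := by omega
        rw [this]
        exact dvd_add h1 (dvd_refl p)
      rw [clean_of_not_dvd hBndvd, hBupd]
      exact hA
    have hle : N (m + 1) ≤ Finset.sum Finset.univ (fun j => B j) := by
      have hc : clean p 1 κ (run p 1 κ c₀ i t (m + 1)) B ≠ 0 := by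
        rw [run_succ, clean_step, ← run_succ]
        exact hstep
      exact ord_le hc
    have hsumB : Finset.sum Finset.univ (fun j => B j) = A (i m) - p := by
      rw [Fintype.sum_eq_single (i m) (fun j hj => (hj (Subsingleton.elim j (i m))).elim)]
    have hNm : N m = A (i m) := by rw [hN]; exact hordA.trans hsumA
    have h2 : p ≤ A (i m) := hsumA ▸ hpA
    omega
  have hbound : ∀ m, N m + m * p ≤ N 0 := by
    intro m
    induction m with
    | zero => simp
    | succ m ih =>
      have := hdrop m
      rw [Nat.succ_mul]
      omega
  have hpos : ∀ m, p ≤ N m := fun m => le_ord_clean_of_multP (hM m)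
  have h1 := hbound (N 0)
  have h2 := hpos (N 0)
  have h3 := hpos 0
  have hp2 : 2 ≤ p := hp.two_le
  nlinarith

/-- **`MultP` is load-bearing (trivially): without it, smooth germs run forever.** The crux's
conclusion with `MultP` deleted. [folklore] -/
def IsolatedForcedTerminationWithoutMultP : Prop :=
  ∀ p : ℕ, p.Prime → ∀ n : ℕ, 0 < n → ∀ (κ : Type) [Field κ] [CharP κ p] [PerfectField κ]
    (c₀ : (Fin n → ℕ) → κ) (i : ℕ → Fin n) (t : ℕ → Fin n → κ),
    ¬ (∀ m, Isol p n κ (run p n κ c₀ i t m))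

/-- The smooth germ `a = u₀` (`n = 1`): coefficient `1` at the exponent `1`. [folklore] -/
def lin (κ : Type) [Field κ] : (Fin 1 → ℕ) → κ := fun A => if A 0 = 1 then 1 else 0

theorem clean_lin (hp : p.Prime) : clean p 1 κ (lin κ) = lin κ := by
  funext A
  unfold clean lin
  split_ifs with h1 h2
  · exact absurd (h2 ▸ h1 0) hp.not_dvd_one
  · rfl
  · rfl
  · rfl

theorem ord_lin : ord 1 κ (lin κ) = 1 := by
  unfold ord
  have : {m : ℕ | ∃ A, lin κ A ≠ 0 ∧ m = Finset.sum Finset.univ (fun j => A j)} = {1} := by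
    ext m
    simp only [Set.mem_setOf_eq, Set.mem_singleton_iff, lin, ne_eq, ite_eq_right_iff,
      one_ne_zero, imp_false, not_not, Fin.sum_univ_one]
    constructor
    · rintro ⟨A, hA, rfl⟩; exact hA
    · intro hm; exact ⟨fun _ => 1, rfl, hm⟩
  rw [this, csInf_singleton]

theorem step_lin (hp : p.Prime) (i : Fin 1) (τ : Fin 1 → κ) : step p 1 κ i τ (lin κ) = lin κ := by
  rw [step_fin_one, clean_lin hp, ord_lin, if_neg (by have := hp.two_le; omega)]
  conv_rhs => rw [← clean_lin hp]
  congr 1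
  funext B
  simp

theorem run_lin (hp : p.Prime) (i : ℕ → Fin 1) (t : ℕ → Fin 1 → κ) (m : ℕ) :
    run p 1 κ (lin κ) i t m = lin κ := by
  induction m with
  | zero => rfl
  | succ m ih => rw [run_succ, ih, step_lin hp]

/-- `∂(u₀)/∂u₀ = 1`: the Jacobian ideal of the smooth germ is everything. [folklore] -/
theorem pd_ser_lin (hp : p.Prime) (i : Fin 1) : pd 1 κ i (ser p 1 κ (lin κ)) = 1 := by
  ext A
  show ((A i + 1 : ℕ) : κ) * clean p 1 κ (lin κ) ⇑(A + Finsupp.single i (1 : ℕ)) =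
    MvPowerSeries.coeff A 1
  rw [clean_lin hp, MvPowerSeries.coeff_one]
  unfold lin
  simp only [Finsupp.coe_add, Pi.add_apply, Subsingleton.elim (0 : Fin 1) i,
    Finsupp.single_eq_same]
  by_cases hA : A = 0
  · subst hA; simp
  · have hAi : A i ≠ 0 := by
      intro h; apply hA; refine Finsupp.ext fun j => ?_; rw [Subsingleton.elim j i, h]; rfl
    rw [if_neg (by omega), if_neg hA, mul_zero]

theorem isol_lin (hp : p.Prime) : Isol p 1 κ (lin κ) := by
  unfold Isol
  have htop : jac p 1 κ (lin κ) = ⊤ := by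
    rw [Ideal.eq_top_iff_one]
    exact Ideal.subset_span ⟨0, pd_ser_lin hp 0⟩
  rw [htop]
  haveI : Subsingleton (MvPowerSeries (Fin 1) κ ⧸ (⊤ : Ideal (MvPowerSeries (Fin 1) κ))) :=
    Ideal.Quotient.subsingleton_iff.2 rfl
  infer_instance

/-- **Tightness: `MultP` cannot be dropped from the conclusion** (witness: `p = 2`, `n = 1`,
`a = u₀` over `𝔽₂`; any chart/translation words). [folklore] -/
theorem isolatedForcedTermination_false_without_MultP : ¬ IsolatedForcedTerminationWithoutMultP :=
  fun h => h 2 Nat.prime_two 1 one_pos (ZMod 2) (lin (ZMod 2)) (fun _ => 0) (fun _ _ => 0)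
    (fun m => by rw [run_lin Nat.prime_two]; exact isol_lin Nat.prime_two)

end DimOne

section CurveBlowUp

/-! ### The self-reproducing NON-isolated atom `z² = u₀ u₁²` over `𝔽₂` -/

/-- Coefficient function of `a = u₀ · u₁²` (`n = 2`, over `𝔽₂`). [folklore] -/
def cst : (Fin 2 → ℕ) → ZMod 2 := fun A => if A 0 = 1 ∧ A 1 = 2 then 1 else 0

theorem cst_ne_zero_iff (A : Fin 2 → ℕ) : cst A ≠ 0 ↔ A 0 = 1 ∧ A 1 = 2 := by
  unfold cst
  split_ifs with h <;> simp [h]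

theorem clean_cst : clean 2 2 (ZMod 2) cst = cst := by
  funext A
  unfold clean
  split_ifs with h
  · symm
    by_contra hne
    have h0 := ((cst_ne_zero_iff A).1 (Ne.symm hne ∘ Eq.symm)).1
    have := h 0
    omega
  · rfl

theorem ord_cst : ord 2 (ZMod 2) cst = 3 := by
  unfold ord
  have : {m : ℕ | ∃ A, cst A ≠ 0 ∧ m = Finset.sum Finset.univ (fun j => A j)} = {3} := by
    ext m
    simp only [Set.mem_setOf_eq, Set.mem_singleton_iff, cst_ne_zero_iff, Fin.sum_univ_two]
    constructor
    · rintro ⟨A, ⟨h0, h1⟩, rfl⟩; omega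
    · intro hm; exact ⟨![1, 2], by simp, by simp [hm]⟩
  rw [this, csInf_singleton]

theorem erase_zero_fin_two : (Finset.univ : Finset (Fin 2)).erase 0 = {1} := by decide

/-- Strict transform in the chart `u₀`: `u₀ u₁² ↦ u₀³ u₁² ↦ u₀ u₁²` — the same state. [folklore] -/
theorem dv_bl_cst : dv 2 (ZMod 2) 0 2 (bl 2 (ZMod 2) 0 cst) = cst := by
  funext B
  unfold dv bl
  simp only [erase_zero_fin_two, Finset.sum_singleton, Function.update_self, ne_eq,
    one_ne_zero, not_false_eq_true, Function.update_of_ne]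
  unfold cst
  simp only [Function.update_self, ne_eq, one_ne_zero, not_false_eq_true, Function.update_of_ne]
  by_cases h1 : B 1 = 2
  · simp [h1]
  · simp [h1]

theorem step_cst : step 2 2 (ZMod 2) 0 (fun _ => 0) cst = cst := by
  unfold step
  rw [clean_cst, ord_cst, if_pos (by norm_num), tr_zero, dv_bl_cst, clean_cst]

theorem run_cst (m : ℕ) : run 2 2 (ZMod 2) cst (fun _ => 0) (fun _ _ => 0) m = cst := by
  induction m with
  | zero => rfl
  | succ m ih => rw [run_succ, ih]; exact step_cst

theorem multP_cst : MultP 2 2 (ZMod 2) cst := by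
  unfold MultP
  rw [clean_cst]
  refine ⟨⟨![1, 2], by simp [cst]⟩, fun A hA => ?_⟩
  rw [cst_ne_zero_iff] at hA
  simp [Fin.sum_univ_two, hA.1, hA.2]

/-- `PairIso` is reflexive. [folklore] -/
theorem PairIso.refl {p : ℕ} (hp : p ≠ 0) (n : ℕ) (κ : Type) [Field κ] (c : (Fin n → ℕ) → κ) :
    PairIso p n κ c c :=
  ⟨AlgEquiv.refl, 1, 0, isUnit_one, by simp [zero_pow hp]⟩

/-- The crux's conclusion with `Isol` (forcedness) deleted: "no eternal multiplicity-`p` run of the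
point-blow-up dynamics". [folklore] -/
def IsolatedForcedTerminationWithoutIsol : Prop :=
  ∀ p : ℕ, p.Prime → ∀ n : ℕ, 0 < n → ∀ (κ : Type) [Field κ] [CharP κ p] [PerfectField κ]
    (c₀ : (Fin n → ℕ) → κ) (i : ℕ → Fin n) (t : ℕ → Fin n → κ),
    ¬ (∀ m, MultP p n κ (run p n κ c₀ i t m))

/-- **Tightness: `Isol` cannot be dropped from the conclusion.** Witness `p = 2`, `n = 2`, `κ = 𝔽₂`,
`a = u₀ u₁²`, chart word `0,0,…`, translations `0`: the run is CONSTANT (`run_cst`), every state has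
multiplicity `2`. (The unforced curve-blow-up configuration: `Sing(z² = u₀u₁²)` is the `u₀`-axis.)
[folklore] -/
theorem isolatedForcedTermination_false_without_Isol : ¬ IsolatedForcedTerminationWithoutIsol :=
  fun h => h 2 Nat.prime_two 2 two_pos (ZMod 2) cst (fun _ => 0) (fun _ _ => 0)
    (fun m => by rw [run_cst]; exact multP_cst)

/-- The certificate with `Isol` deleted: "no multiplicity-`p` chain over a field algebraic over `𝔽_p`
returns to a pair-isomorphic state". [folklore] -/
def NoPeriodicIsolatedAtomWithoutIsol : Prop :=
  ∀ p : ℕ, p.Prime → ∀ n : ℕ, 0 < n → ∀ (κ : Type) [Field κ] [Algebra (ZMod p) κ]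
    [Algebra.IsAlgebraic (ZMod p) κ] (c₀ : (Fin n → ℕ) → κ) (i : ℕ → Fin n) (t : ℕ → Fin n → κ)
    (r : ℕ), 0 < r →
    (∀ m, m ≤ r → MultP p n κ (run p n κ c₀ i t m)) →
      ¬ PairIso p n κ (run p n κ c₀ i t 0) (run p n κ c₀ i t r)

/-- **Tightness: `Isol` cannot be dropped from the certificate either** — the same atom is
1-periodic ON THE NOSE over the prime field (`r = 1`, `φ = id`, `v = 1`, `g = 0`). So the
non-isolated arena has periodic atoms for free; the content of rank 2 is entirely in `Isol`.
[folklore] -/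
theorem noPeriodicIsolatedAtom_false_without_Isol : ¬ NoPeriodicIsolatedAtomWithoutIsol :=
  fun h => h 2 Nat.prime_two 2 two_pos (ZMod 2) cst (fun _ => 0) (fun _ _ => 0) 1 one_pos
    (fun m _ => by rw [run_cst]; exact multP_cst)
    (by rw [run_cst, run_cst]; exact PairIso.refl two_ne_zero 2 (ZMod 2) cst)

/-- `∂(u₀u₁²)/∂u₀ = u₁²`. [folklore] -/
theorem pd_zero_ser_cst : pd 2 (ZMod 2) 0 (ser 2 2 (ZMod 2) cst) = MvPowerSeries.X 1 ^ 2 := by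
  ext A
  show ((A 0 + 1 : ℕ) : ZMod 2) * clean 2 2 (ZMod 2) cst ⇑(A + Finsupp.single (0 : Fin 2) (1 : ℕ)) =
    MvPowerSeries.coeff A (MvPowerSeries.X 1 ^ 2)
  rw [clean_cst, MvPowerSeries.coeff_X_pow]
  unfold cst
  simp only [Finsupp.coe_add, Pi.add_apply, Finsupp.single_eq_same, ne_eq, one_ne_zero,
    not_false_eq_true, Finsupp.single_eq_of_ne, add_zero, Nat.add_eq_right]
  by_cases hA : A = Finsupp.single (1 : Fin 2) (2 : ℕ)
  · subst hA; simp
  · rw [if_neg hA, if_neg, mul_zero]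
    rintro ⟨h0, h1⟩
    apply hA
    ext j
    fin_cases j
    · simpa using h0
    · simpa using h1

/-- `∂(u₀u₁²)/∂u₁ = 2u₀u₁ = 0` in characteristic `2`. [folklore] -/
theorem pd_one_ser_cst : pd 2 (ZMod 2) 1 (ser 2 2 (ZMod 2) cst) = 0 := by
  ext A
  show ((A 1 + 1 : ℕ) : ZMod 2) * clean 2 2 (ZMod 2) cst ⇑(A + Finsupp.single (1 : Fin 2) (1 : ℕ)) =
    MvPowerSeries.coeff A 0
  rw [clean_cst, map_zero]
  unfold cst
  simp only [Finsupp.coe_add, Pi.add_apply, Finsupp.single_eq_same, ne_eq, zero_ne_one,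
    not_false_eq_true, Finsupp.single_eq_of_ne, add_zero]
  split_ifs with h
  · obtain ⟨-, h1⟩ := h
    have : A 1 = 1 := by omega
    rw [this]
    decide
  · rw [mul_zero]

/-- The Jacobian ideal of `u₀u₁²` over `𝔽₂` is contained in `(u₁²)`. [folklore] -/
theorem jac_cst_le : jac 2 2 (ZMod 2) cst ≤ Ideal.span {MvPowerSeries.X 1 ^ 2} := by
  unfold jac
  rw [Ideal.span_le]
  rintro f ⟨i, rfl⟩
  fin_cases i
  · exact Ideal.subset_span (by simp [pd_zero_ser_cst])
  · simp [pd_one_ser_cst]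

/-- **The witness is genuinely NON-isolated** (so it refutes the weakening, not the target): the
powers `u₀ᵏ` are linearly independent in the Milnor algebra `𝔽₂[[u₀,u₁]]/jac`, because an element
of `jac ⊆ (u₁²)` has no pure-`u₀` monomials. [folklore] -/
theorem not_isol_cst : ¬ Isol 2 2 (ZMod 2) cst := by
  intro hfin
  unfold Isol at hfin
  set J := jac 2 2 (ZMod 2) cst with hJ
  -- the family `k ↦ [u₀ ^ k]`
  have hli : LinearIndependent (ZMod 2)
      (fun k : ℕ => Ideal.Quotient.mk J (MvPowerSeries.X 0 ^ k)) := by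
    rw [linearIndependent_iff']
    intro s a hs k hk
    have hsum : Ideal.Quotient.mk J (s.sum fun j => a j • MvPowerSeries.X (0 : Fin 2) ^ j) = 0 := by
      rw [map_sum, ← hs]
      exact Finset.sum_congr rfl fun _ _ => rfl
    rw [Ideal.Quotient.eq_zero_iff_mem] at hsum
    have hdvd : MvPowerSeries.X (1 : Fin 2) ^ 2 ∣
        s.sum fun j => a j • MvPowerSeries.X (0 : Fin 2) ^ j :=
      Ideal.mem_span_singleton.1 (jac_cst_le hsum)
    rw [MvPowerSeries.X_pow_dvd_iff] at hdvd
    have hk0 := hdvd (Finsupp.single 0 k) (by simp)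
    rw [map_sum, Finset.sum_eq_single k] at hk0
    · simpa [MvPowerSeries.coeff_X_pow] using hk0
    · intro j _ hjk
      rw [map_smul, MvPowerSeries.coeff_X_pow, if_neg, smul_zero]
      intro h
      apply hjk
      have := congrArg (fun f => f 0) h
      simpa using this.symm
    · intro hks; exact (hks hk).elim
  haveI : Module.Finite (ZMod 2) (MvPowerSeries (Fin 2) (ZMod 2) ⧸ J) := hfin
  have : Finite ℕ := hli.finite_of_isNoetherian
  exact not_finite ℕ

end CurveBlowUp

end Summit.ResolutionOfSingularities.ResolutionOfSingularities.Cruxes.ClosingReduction.Disproof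

end
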